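import Literature.NumberTheory.EllipticCurves.TorsionGaloisRepMatrixModFourProofs
import Literature.NumberTheory.EllipticCurves.TwoAdicImageModEightArithmeticProofs
import Literature.NumberTheory.GaloisRepresentations.GL2ModFourTraceDetCertificateProofs
import HarnessLib

/-!
# `ζ₄`, `√-1`, `√-Δ` in `K(E[4])`, and: `ρ̄₄` onto or the image lies in `ℍ` (proofs only)

Sorry-free `Proofs` companion (bookkeeping definitions and theorems only; no named fact, no
instance; D-0014/D-0026) — door B pieces (iii)–(iv) of the level-`4` programme of
T. Dokchitser, V. Dokchitser, *Surjectivity of mod `2ⁿ` representations of elliptic curves*,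
Math. Z. 272 (2012) 961–964, proof of Theorem (2).  For an elliptic curve `E/K`, `char K ≠ 2`, in a
frame `E[4] ≅ (ℤ/4)²` with basis `P₀, Q₀` and `ζ = e₄(P₀, Q₀)` (all in the sub-namespace
`LevelFour`):

* §1 `σζ = ζ^{det ρ̄₄(σ)}` (`smul_zeta`), `ζ² = -1` (`zeta_sq`, non-degeneracy of `e₄`), hence
  `σζ = χ₋₁(det ρ̄₄σ)·ζ` (`smul_zeta_eq`);
* §2 `σδ = sgn(ρ̄₄(σ) mod 2)·δ` for `δ = ∏_{i<j}(x_i - x_j)`, `Δ = 16δ²` (`smul_delta_eq`; the letters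
  `2P₀, 2Q₀, 2(P₀+Q₀)` of `E[2] ⊂ E[4]`);
* §3 the witnesses: `√-1 ∉ K ⟹ ∃ σ, χ₋₁(det ρ̄₄σ) = -1` (`exists_cm1_eq_one`) and
  `-Δ ∉ K^{×2} ⟹ ∃ σ, χ₋₁(det ρ̄₄σ)·sgn(ρ̄₄σ mod 2) = -1` (`exists_cm1_add_sg_eq_one`, via `ζδ` with
  `(4ζδ)² = -Δ`);
* §4 assembly with `GL2Mod4.surjective_or_conj_subset_HH` and `exists_par_rhoMat_eq_of_two`:
  **`hasSurjectiveModNGaloisRep_four_or_conj_subset_HH`** — `ρ̄₂` onto, `√-1 ∉ K`, `-Δ ∉ K^{×2}`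
  ⟹ `ρ̄₄` onto, or a conjugate of `Im ρ̄₄` (in the frame) lies in `ℍ` — its `ℚ`-form, and the
  trace–determinant certificate `hasSurjectiveModNGaloisRep_four_of_trace_two_det_three`.

NOT in this file (the residue of clause (2) of the Theorem): Dokchitser–Dokchitser's Lemma
(`Im ρ̄₄ ≤ conj ℍ ⟺ j = -4t³(t+8)` for `y² = x³ + ax + b`, `b ≠ 0`), the bridge `ρ̄₂` onto
`⟹ j ≠ 1728` (the case `b = 0`), and the `↔`-packaging
`ρ̄₄ onto ↔ ρ̄₂ onto ∧ -Δ ∉ K^{×2} ∧ ¬(Im ρ̄₄ conjugate into ℍ)` with its easy converses.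

## References

* [DokchitserDokchitserMathZ2012] T. Dokchitser, V. Dokchitser, Math. Z. 272 (2012) 961–964,
  Theorem (2) and its proof. [corpus:paper:arxiv-1104.5031 p0001 L77–L104]
* [SilvermanAEC2009] J. H. Silverman, *The Arithmetic of Elliptic Curves*, 2nd ed., GTM 106
  (2009), III.6.4(b), III.7, III.8.
-/

set_option autoImplicit false

noncomputable section

open scoped Classical

open Matrix WeierstrassCurve

namespace Literature.NumberTheory.EllipticCurves.DokchitserDokchitser2012

namespace LevelFour

open Literature.NumberTheory.GaloisRepresentations.GL2Mod8 (P4 P4.mul P4.det eps sgnUnit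
  sgnUnit_zero sgnUnit_one sgnUnit_add)
open Literature.NumberTheory.GaloisRepresentations.GL2Mod4

universe u

variable {K : Type u} [Field K] (W : WeierstrassCurve K) [W.IsElliptic]

/-- `4 ≠ 0` in `K` when `2 ≠ 0`. [folklore] -/
private theorem four_ne_zero' (h2 : (2 : K) ≠ 0) : ((4 : ℕ) : K) ≠ 0 := by
  rw [show ((4 : ℕ) : K) = 2 ^ 2 by norm_num]
  exact pow_ne_zero 2 h2

variable (h2 : (2 : K) ≠ 0)

/-- A frame `E[4] ≅ (ℤ/4)²` (Silverman, *AEC*, Cor. III.6.4(b); tree theorem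
`nonempty_geomTorsion_addEquiv_fin_two`). [folklore] -/
def frame4 : geomTorsion W 4 ≃+ (Fin 2 → ZMod 4) :=
  (nonempty_geomTorsion_addEquiv_fin_two W (m := 4) (four_ne_zero' h2)).some

/-- The basis point `P₀ = e⁻¹δ₀` of `E[4]` (bookkeeping). [folklore] -/
abbrev P0 : geomTorsion W 4 := (frame4 W h2).symm (Pi.single 0 1)

/-- The basis point `Q₀ = e⁻¹δ₁` of `E[4]` (bookkeeping). [folklore] -/
abbrev Q0 : geomTorsion W 4 := (frame4 W h2).symm (Pi.single 1 1)

/-- `ρ̄_{E,4}(σ)` as a matrix in the frame (bookkeeping abbreviation for `rhoMat`). [folklore] -/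
abbrev M (σ : Field.absoluteGaloisGroup K) : M4 := rhoMat W (frame4 W h2) σ

/-! ### §1. `ζ = e₄(P₀, Q₀)`: `σζ = ζ^{det}`, `ζ² = -1` -/

/-- `ζ = e₄(P₀, Q₀) ∈ K̄`, the Weil pairing of the frame's basis (Silverman, *AEC*, III.8).
[folklore] -/
def zeta : AlgebraicClosure K :=
  weilPairingFun (four_ne_zero' h2) (P0 W h2 : geomPoints W) (Q0 W h2 : geomPoints W)

/-- The Weil pairing restricted to `E[4]` (bookkeeping). [folklore] -/
private abbrev e4 (S T : geomTorsion W 4) : AlgebraicClosure K :=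
  weilPairingFun (four_ne_zero' h2) (S : geomPoints W) (T : geomPoints W)

/-- `e₄` on `E[4]` takes values in `μ₄` and is biadditive and alternating.
[cite: SilvermanAEC2009, Prop. III.8.1 (a)–(b)] -/
theorem e4_props :
    (∀ S T, e4 W h2 S T ^ 4 = 1) ∧ (∀ S₁ S₂ T, e4 W h2 (S₁ + S₂) T = e4 W h2 S₁ T * e4 W h2 S₂ T) ∧
      (∀ S T₁ T₂, e4 W h2 S (T₁ + T₂) = e4 W h2 S T₁ * e4 W h2 S T₂) ∧ ∀ T, e4 W h2 T T = 1 := by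
  have mem := zsmul_coe_geomTorsion (W := W) (m := 4)
  exact ⟨fun S T ↦ weilPairingFun_pow _ (mem S) (mem T),
    fun S₁ S₂ T ↦ weilPairingFun_add_left _ (mem S₁) (mem S₂) (mem T),
    fun S T₁ T₂ ↦ weilPairingFun_add_right _ (mem S) (mem T₁) (mem T₂),
    fun T ↦ weilPairingFun_self _ (mem T)⟩

/-- `ζ⁴ = 1`. [cite: SilvermanAEC2009, Prop. III.8.1 (e_m takes values in μ_m)] -/
theorem zeta_pow_four : zeta W h2 ^ 4 = 1 := (e4_props W h2).1 _ _

/-- `X = (eX)₀ P₀ + (eX)₁ Q₀`. [cite: SilvermanAEC2009, Cor. III.6.4(b) (E[m] ≅ ℤ/mℤ × ℤ/mℤ)] -/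
theorem eq_P0_Q0 (X : geomTorsion W 4) :
    X = (frame4 W h2 X 0).val • P0 W h2 + (frame4 W h2 X 1).val • Q0 W h2 :=
  eq_nsmul_add_nsmul (frame4 W h2) X

/-- `e₄(aP₀ + cQ₀, bP₀ + dQ₀) = ζ^{ad + 3bc}`. [cite: SilvermanAEC2009, Prop. III.8.1 (bilinear, alternating)] -/
theorem e4_eq_zeta_pow (a b c d : ℕ) :
    e4 W h2 (a • P0 W h2 + c • Q0 W h2) (b • P0 W h2 + d • Q0 W h2) =
      zeta W h2 ^ (a * d + 3 * (b * c)) := by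
  obtain ⟨hμ, hadd₁, hadd₂, halt⟩ := e4_props W h2
  exact pairing_generators_eq_pow hμ hadd₁ hadd₂ halt (by norm_num) _ _ a c b d

/-- Powers of `ζ` only depend on the exponent modulo `4`. [folklore] -/
private theorem zeta_pow_mod (n : ℕ) : zeta W h2 ^ n = zeta W h2 ^ (n % 4) := by
  conv_lhs => rw [← Nat.div_add_mod n 4, pow_add, pow_mul, zeta_pow_four, one_pow, one_mul]

/-- **`σζ = ζ^{det ρ̄₄(σ)}`** (`Gal(K(E[4])/K) → (ℤ/4ℤ)^×` is the determinant, by equivariance,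
bilinearity and alternation of `e₄`). [cite: DokchitserDokchitserMathZ2012, proof of the Theorem (Weil pairing: the map to (ℤ/nℤ)^× is the determinant)] -/
theorem smul_zeta (σ : Field.absoluteGaloisGroup K) :
    σ • zeta W h2 = zeta W h2 ^ ((M W h2 σ).det).val := by
  have mem := zsmul_coe_geomTorsion (W := W) (m := 4)
  have hP := eq_P0_Q0 W h2 (σ • P0 W h2)
  have hQ := eq_P0_Q0 W h2 (σ • Q0 W h2)
  have hcol : ∀ j i, frame4 W h2 (σ • (frame4 W h2).symm (Pi.single j 1)) i = M W h2 σ i j := by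
    intro j i
    rw [rhoMat_mulVec, AddEquiv.apply_symm_apply]
    simp [Matrix.mulVec, dotProduct, Pi.single_apply]
  rw [hcol 0 0, hcol 0 1] at hP
  rw [hcol 1 0, hcol 1 1] at hQ
  have lhs : σ • zeta W h2 = e4 W h2 (σ • P0 W h2) (σ • Q0 W h2) := by
    rw [zeta, ← weilPairingFun_smul _ σ (mem _) (mem _)]
    rfl
  rw [lhs, hP, hQ, e4_eq_zeta_pow, zeta_pow_mod, zeta_pow_mod W h2 (M W h2 σ).det.val]
  congr 1
  rw [Matrix.det_fin_two, ← ZMod.val_natCast, ← ZMod.val_natCast]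
  congr 1
  push_cast
  rw [ZMod.natCast_zmod_val, ZMod.natCast_zmod_val, ZMod.natCast_zmod_val, ZMod.natCast_zmod_val,
    ZMod.natCast_zmod_val, show (3 : ZMod 4) = -1 by decide]
  ring

/-- **`ζ² = -1`** (`ζ = e₄(P₀, Q₀)` is a primitive fourth root of unity: if `ζ² = 1` then `2P₀ ≠ O`
would pair trivially with all of `E[4]`, contradicting non-degeneracy; Silverman, *AEC*,
Cor. III.8.1.1). [cite: SilvermanAEC2009, Cor. III.8.1.1] -/
theorem zeta_sq : zeta W h2 ^ 2 = -1 := by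
  have mem := zsmul_coe_geomTorsion (W := W) (m := 4)
  have h4 : (zeta W h2 ^ 2) * (zeta W h2 ^ 2) = 1 := by rw [← pow_add]; exact zeta_pow_four W h2
  rcases mul_self_eq_one_iff.mp h4 with h | h
  · exfalso
    have htriv : ∀ T : geomPoints W, ((4 : ℕ) : ℤ) • T = 0 →
        weilPairingFun (four_ne_zero' h2) ((2 • P0 W h2 : geomTorsion W 4) : geomPoints W) T = 1 := by
      intro T hT
      set T' : geomTorsion W 4 := ⟨T, (mem_torsionPoints_iff _ _ T).mpr hT⟩
      have hT' := eq_P0_Q0 W h2 T'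
      have : T = (T' : geomPoints W) := rfl
      rw [this, hT', show (2 • P0 W h2 : geomTorsion W 4) = 2 • P0 W h2 + 0 • Q0 W h2 by
        rw [zero_nsmul, add_zero]]
      change e4 W h2 _ _ = 1
      rw [e4_eq_zeta_pow, mul_zero, mul_zero, add_zero, pow_mul, h, one_pow]
    have h0 := eq_zero_of_weilPairingFun_eq_one_left (four_ne_zero' h2) (mem _) htriv
    have h2' : (2 • P0 W h2 : geomTorsion W 4) = 0 := Subtype.ext h0
    have := congrArg (frame4 W h2) h2'
    rw [map_nsmul, AddEquiv.apply_symm_apply, map_zero] at this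
    have h5 := congr_fun this 0
    simp [nsmul_eq_mul] at h5
    exact absurd h5 (by decide)
  · exact h

/-- `det ρ̄₄(σ)` is `1` or `3`. [folklore] -/
private theorem det_cases (σ : Field.absoluteGaloisGroup K) :
    (M W h2 σ).det = 1 ∨ (M W h2 σ).det = 3 :=
  (by decide : ∀ d : ZMod 4, red d = 1 → d = 1 ∨ d = 3) _
    ((GaloisRepresentations.GL2Mod4.mul_self_eq_one_iff _).mp (det_sq (rhoMat W (frame4 W h2)) σ).1)

/-- **`σζ = χ₋₁(det ρ̄₄σ)·ζ`**: `ζ^d` is `ζ` for `d = 1` and `-ζ` for `d = 3`.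
[cite: DokchitserDokchitserMathZ2012, proof of the Theorem (ℚ(E[4]) ⊃ ℚ(√-1); Gal → (ℤ/4ℤ)^× is det)] -/
theorem smul_zeta_eq (σ : Field.absoluteGaloisGroup K) :
    σ • zeta W h2 = (sgnUnit (cm1 (M W h2 σ).det) : AlgebraicClosure K) * zeta W h2 := by
  rw [smul_zeta]
  rcases det_cases W h2 σ with h | h <;> rw [h]
  · rw [show cm1 1 = 0 by decide, sgnUnit_zero, show (1 : ZMod 4).val = 1 from rfl, pow_one]
    push_cast; ring
  · rw [show cm1 3 = 1 by decide, sgnUnit_one, show (3 : ZMod 4).val = 3 from rfl, pow_succ,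
      zeta_sq]
    push_cast; ring

/-! ### §2. `σδ = sgn(ρ̄₄(σ) mod 2) · δ` -/

/-- `w = (δ₀, δ₁, δ₀ + δ₁)` over `ℤ/4` (bookkeeping). [folklore] -/
abbrev wvec : Fin 3 → (Fin 2 → ZMod 4) := ![Pi.single 0 1, Pi.single 1 1, Pi.single 0 1 + Pi.single 1 1]

/-- `L_i = e⁻¹(2 w_i) ∈ E[4]`: the three nonzero `2`-torsion points (bookkeeping). [folklore] -/
abbrev L (i : Fin 3) : geomTorsion W 4 := (frame4 W h2).symm (2 • wvec i)

omit [W.IsElliptic] in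
/-- `L_i`, as a geometric point, lies in `E[2]` and is nonzero. [cite: SilvermanAEC2009, Cor. III.6.4(b) (E[m] ≅ ℤ/mℤ × ℤ/mℤ)] -/
theorem L_mem_two (e : geomTorsion W 4 ≃+ (Fin 2 → ZMod 4)) (i : Fin 3) :
    ((e.symm (2 • wvec i) : geomTorsion W 4) : geomPoints W) ∈ geomTorsion W 2 ∧
      ((e.symm (2 • wvec i) : geomTorsion W 4) : geomPoints W) ≠ 0 := by
  constructor
  · rw [mem_geomTorsion_two_iff, ← AddSubgroup.coe_add, ← map_add, ← two_nsmul, smul_smul]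
    have : ((2 * 2) • wvec i : Fin 2 → ZMod 4) = 0 := by
      ext k; fin_cases i <;> fin_cases k <;> simp [nsmul_eq_mul] <;> decide
    rw [this, map_zero]; rfl
  · intro h
    have h' : (e.symm (2 • wvec i) : geomTorsion W 4) = 0 := Subtype.ext h
    rw [e.symm.map_eq_zero_iff] at h'
    have := congr_fun h' (if i = 1 then 1 else 0)
    fin_cases i <;> simp [nsmul_eq_mul] at this <;> exact absurd this (by decide)

/-- The letter `f i` with `T_{f i} = L_i` (`E[2] = {O, T₀, T₁, T₂}`). [folklore] -/
def letter (i : Fin 3) : Fin 3 :=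
  ((eq_zero_or_eq_T W h2 ⟨_, (L_mem_two W (frame4 W h2) i).1⟩).resolve_left
    (fun h ↦ (L_mem_two W (frame4 W h2) i).2 (congrArg Subtype.val h))).choose

/-- `T_{f i} = L_i` as geometric points. [cite: SilvermanAEC2009, Cor. III.6.4(b) (E[2] = {O, T₀, T₁, T₂})] -/
theorem coe_T_letter (i : Fin 3) :
    (T W h2 (letter W h2 i) : geomPoints W) = ((L W h2 i : geomTorsion W 4) : geomPoints W) := by
  have h := ((eq_zero_or_eq_T W h2 ⟨_, (L_mem_two W (frame4 W h2) i).1⟩).resolve_left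
    (fun h ↦ (L_mem_two W (frame4 W h2) i).2 (congrArg Subtype.val h))).choose_spec
  exact (congrArg Subtype.val h).symm

/-- `i ↦ f i` is injective (the `L_i` are distinct).
[cite: SilvermanAEC2009, Cor. III.6.4(b) (E[2] = {O, T₀, T₁, T₂})] -/
theorem letter_injective : Function.Injective (letter W h2) := by
  intro i j hij
  have h := congrArg (fun k ↦ (T W h2 k : geomPoints W)) hij
  simp only [coe_T_letter] at h
  have h' : (L W h2 i : geomTorsion W 4) = L W h2 j := Subtype.ext h
  rw [(frame4 W h2).symm.apply_eq_iff_eq] at h'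
  have h0 := congr_fun h' 0
  have h1 := congr_fun h' 1
  fin_cases i <;> fin_cases j <;> simp [nsmul_eq_mul] at h0 h1 ⊢ <;>
    first | exact absurd h0 (by decide) | exact absurd h1 (by decide)

/-- `σ` fixes the letter `f i` iff `ρ̄₄(σ) mod 2` fixes `w̄_i`: `σ L_i = e⁻¹(2 · ρ̄₄(σ) w_i)`.
[cite: SilvermanAEC2009, III.7 (the Galois action on E[2] ⊂ E[4])] -/
theorem permGal_letter_eq_iff (σ : Field.absoluteGaloisGroup K) (i : Fin 3) :
    permGal W h2 σ (letter W h2 i) = letter W h2 i ↔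
      2 • (M W h2 σ *ᵥ wvec i) = 2 • wvec i := by
  rw [← (T_injective W h2).eq_iff, T_permGal, ← Subtype.coe_inj, AddSubgroup.torsionBy.coe_smul,
    coe_T_letter, ← AddSubgroup.torsionBy.coe_smul, Subtype.coe_inj,
    ← (frame4 W h2).apply_eq_iff_eq, rhoMat_mulVec, AddEquiv.apply_symm_apply,
    Matrix.mulVec_smul]

/-- The parity labels `w̄_i`, stored as the first column of a parity vector (bookkeeping).
[folklore] -/
private abbrev wbar : Fin 3 → P4 := ![(1, 0, 0, 0), (0, 0, 1, 0), (1, 0, 1, 0)]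

/-- A parity matrix of determinant `1` has `eps = 1` iff it fixes exactly one nonzero vector.
[folklore] -/
private theorem eps_eq_one_iff_card (p : P4) (hp : P4.det p = 1) :
    eps p = 1 ↔ (Finset.univ.filter fun i : Fin 3 ↦
      (P4.mul p (wbar i)).1 = (wbar i).1 ∧ (P4.mul p (wbar i)).2.2.1 = (wbar i).2.2.1).card = 1 := by
  revert p; decide

/-- A permutation of three letters is odd iff it fixes exactly one letter. [folklore] -/
private theorem sign_eq_neg_one_iff_card (q : Equiv.Perm (Fin 3)) :
    Equiv.Perm.sign q = -1 ↔ (Finset.univ.filter fun i : Fin 3 ↦ q i = i).card = 1 := by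
  revert q; decide

/-- `2 • (N w) = 2 • w` in `(ℤ/4)²` is the parity statement `N̄ w̄ = w̄`. [folklore] -/
private theorem two_nsmul_mulVec_eq_iff (N : M4) (i : Fin 3) :
    2 • (N *ᵥ wvec i) = 2 • wvec i ↔
      ((P4.mul (par N) (wbar i)).1 = (wbar i).1 ∧ (P4.mul (par N) (wbar i)).2.2.1 = (wbar i).2.2.1) := by
  have key0 : ∀ x : ZMod 4, 2 * x = 0 ↔ red x = 0 := by decide
  have key1 : ∀ x : ZMod 4, 2 * x = 2 ↔ red x = 1 := by decide
  have key2 : ∀ x y : ZMod 4, 2 * x + 2 * y = 2 ↔ red x + red y = 1 := by decide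
  rw [funext_iff, Fin.forall_fin_two]
  fin_cases i <;>
    simp [Matrix.mulVec, dotProduct, Fin.sum_univ_two, Pi.single_apply, nsmul_eq_mul, par, Q4.par,
      tup, P4.mul, wbar, key0, key1, key2]

/-- **`σδ = sgn(ρ̄₄(σ) mod 2) · δ`**: the sign of `permGal σ` on `{T₀, T₁, T₂}` is the sign of
`ρ̄₄(σ) mod 2 ∈ GL₂(𝔽₂) ≅ S₃`. [cite: DokchitserDokchitserMathZ2012, proof of the Theorem (ℚ(E[2]) ⊃ ℚ(√Δ); GL₂ → S₃ is reduction mod 2)] -/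
theorem smul_delta_eq (σ : Field.absoluteGaloisGroup K) :
    σ • delta W h2 = (sgnUnit (sg (M W h2 σ)) : AlgebraicClosure K) * delta W h2 := by
  rw [smul_delta]
  congr 1
  have hdet : P4.det (par (M W h2 σ)) = 1 := par_det_one (rhoMat W (frame4 W h2)) σ
  have hcard : (Finset.univ.filter fun j : Fin 3 ↦ permGal W h2 σ j = j).card =
      (Finset.univ.filter fun i : Fin 3 ↦ 2 • (M W h2 σ *ᵥ wvec i) = 2 • wvec i).card := by
    let π : Fin 3 ≃ Fin 3 := Equiv.ofBijective (letter W h2)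
      (letter_injective W h2).bijective_of_finite
    conv_rhs => rw [← Finset.card_map π.toEmbedding]
    congr 1
    ext j
    simp only [Finset.mem_map_equiv, Finset.mem_filter, Finset.mem_univ, true_and]
    rw [← permGal_letter_eq_iff, show letter W h2 (π.symm j) = π (π.symm j) from rfl,
      Equiv.apply_symm_apply]
  by_cases hs : sg (M W h2 σ) = 1
  · rw [hs, sgnUnit_one]
    have h1 : Equiv.Perm.sign (permGal W h2 σ) = -1 := by
      rw [sign_eq_neg_one_iff_card, hcard]
      have key := (eps_eq_one_iff_card _ hdet).mp hs
      convert key using 2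
      exact Finset.filter_congr fun i _ ↦ two_nsmul_mulVec_eq_iff _ i
    rw [h1]; push_cast; rfl
  · have hs0 : sg (M W h2 σ) = 0 := by
      rcases (by decide : ∀ z : ZMod 2, z = 0 ∨ z = 1) (sg (M W h2 σ)) with h | h
      · exact h
      · exact absurd h hs
    rw [hs0, sgnUnit_zero]
    have h1 : Equiv.Perm.sign (permGal W h2 σ) ≠ -1 := by
      rw [Ne, sign_eq_neg_one_iff_card, hcard]
      intro hc
      apply hs
      apply (eps_eq_one_iff_card _ hdet).mpr
      convert hc using 2
      exact Finset.filter_congr fun i _ ↦ (two_nsmul_mulVec_eq_iff _ i).symm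
    rcases Int.units_eq_one_or (Equiv.Perm.sign (permGal W h2 σ)) with h | h
    · rw [h]; push_cast; rfl
    · exact absurd h h1

/-! ### §3. The witnesses: `√-1 ∉ K`, `-Δ ∉ K^{×2}` -/

/-- An element of `K̄` fixed by `Γ_K` lies in `K` (`K` perfect, `K̄/K` Galois). [folklore] -/
private theorem exists_eq_algebraMap [PerfectField K] {x : AlgebraicClosure K}
    (hx : ∀ σ : Field.absoluteGaloisGroup K, σ • x = x) : ∃ q : K, algebraMap K _ q = x := by
  haveI : IsGalois K (AlgebraicClosure K) := {}
  exact (InfiniteGalois.mem_range_algebraMap_iff_fixed x).mpr fun σ ↦ hx σ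

/-- **`√-1 ∉ K` ⟹ some `σ` moves `ζ`**, i.e. `χ₋₁(det ρ̄₄σ) = -1`: the image is not inside
`ker (χ₋₁∘det)` ("surjects onto `(ℤ/4ℤ)^×`"). [cite: DokchitserDokchitserMathZ2012, proof of Theorem (2) (surjects onto (ℤ/4ℤ)^×)] -/
theorem exists_cm1_eq_one [PerfectField K] (hK : ¬ IsSquare (-1 : K)) :
    ∃ σ : Field.absoluteGaloisGroup K, cm1 (M W h2 σ).det = 1 := by
  by_contra hno
  push Not at hno
  obtain ⟨q, hq⟩ := exists_eq_algebraMap (x := zeta W h2) fun σ ↦ by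
    rw [smul_zeta_eq, (by decide : ∀ z : ZMod 2, z ≠ 1 → z = 0) _ (hno σ), sgnUnit_zero]; simp
  refine hK ⟨q, (algebraMap K (AlgebraicClosure K)).injective ?_⟩
  rw [map_mul, hq, map_neg, map_one, ← pow_two, zeta_sq]

/-- **`-Δ ∉ K^{×2}` ⟹ some `σ` moves `ζ·δ`** (`-Δ = (4ζδ)²`), i.e. `χ₋₁(det)·sgn = -1` at `σ`
("has a `C₂ × C₂`-quotient": `K(√Δ, √-1)/K` of degree `4`).
[cite: DokchitserDokchitserMathZ2012, proof of Theorem (2) (ℚ(√Δ, √-1) has degree 4)] -/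
theorem exists_cm1_add_sg_eq_one [PerfectField K] (hΔ : ¬ IsSquare (-W.Δ)) :
    ∃ σ : Field.absoluteGaloisGroup K, cm1 (M W h2 σ).det + sg (M W h2 σ) = 1 := by
  by_contra hno
  push Not at hno
  obtain ⟨q, hq⟩ := exists_eq_algebraMap (x := zeta W h2 * delta W h2) fun σ ↦ by
    rw [smul_mul', smul_zeta_eq, smul_delta_eq, mul_mul_mul_comm, ← Int.cast_mul, ← sgnUnit_add,
      (by decide : ∀ z : ZMod 2, z ≠ 1 → z = 0) _ (hno σ), sgnUnit_zero]; simp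
  refine hΔ ⟨4 * q, (algebraMap K (AlgebraicClosure K)).injective ?_⟩
  rw [map_neg, algebraMap_Δ W h2, map_mul, map_mul, map_ofNat, hq]
  have := zeta_sq W h2
  linear_combination (-(16 : AlgebraicClosure K) * delta W h2 ^ 2) * this

/-! ### §4. Assembly: `ρ̄₄` onto, or the image lies in `ℍ` -/

/-- **`ρ̄₂` onto, `√-1 ∉ K`, `-Δ ∉ K^{×2}` ⟹ `ρ̄₄` onto, or a conjugate of `Im ρ̄₄` lies in `ℍ`**
(the normaliser of the non-split Cartan, Dokchitser–Dokchitser's `ℍ` of index `4`), in the frame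
`frame4`. [cite: DokchitserDokchitserMathZ2012, proof of Theorem (2) (the image surjects onto GL₂(ℤ/2ℤ) and (ℤ/4ℤ)^× and has a C₂×C₂-quotient, so it is GL₂(ℤ/4ℤ) or conjugate to ℍ)] -/
theorem hasSurjectiveModNGaloisRep_four_or_conj_subset_HH [PerfectField K]
    (h2s : W.HasSurjectiveModNGaloisRep 2) (hK : ¬ IsSquare (-1 : K)) (hΔ : ¬ IsSquare (-W.Δ)) :
    W.HasSurjectiveModNGaloisRep 4 ∨
      ∃ k : M4, k.det * k.det = 1 ∧ ∀ σ : Field.absoluteGaloisGroup K,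
        tup (k * M W h2 σ * inv' k) ∈ HH := by
  rcases surjective_or_conj_subset_HH (rhoMat W (frame4 W h2))
      (exists_par_rhoMat_eq_of_two W (frame4 W h2) h2s) (exists_cm1_eq_one W h2 hK)
      (exists_cm1_add_sg_eq_one W h2 hΔ) with h | h
  · left
    refine (hasSurjectiveModNGaloisRep_iff_matrix W (frame4 W h2)).mpr fun g ⟨d', hd⟩ ↦ ?_
    exact h g (mul_self_of_mul_eq_one hd)
  · exact Or.inr h

/-- **Trace–determinant certificate for curves**: under `ρ̄₂` onto, `√-1 ∉ K`, `-Δ ∉ K^{×2}`, one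
`σ` with `tr ρ̄₄(σ) = 2`, `det ρ̄₄(σ) = 3` (in `ℤ/4ℤ`, in any frame — here `frame4`) gives `ρ̄₄`
onto. [cite: DokchitserDokchitserMathZ2012, proof of Theorem (2) (the subgroup ℍ of index 4)] -/
theorem hasSurjectiveModNGaloisRep_four_of_trace_two_det_three [PerfectField K]
    (h2s : W.HasSurjectiveModNGaloisRep 2) (hK : ¬ IsSquare (-1 : K)) (hΔ : ¬ IsSquare (-W.Δ))
    (h₃ : ∃ σ : Field.absoluteGaloisGroup K, (M W h2 σ).trace = 2 ∧ (M W h2 σ).det = 3) :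
    W.HasSurjectiveModNGaloisRep 4 := by
  refine (hasSurjectiveModNGaloisRep_iff_matrix W (frame4 W h2)).mpr fun g ⟨d', hd⟩ ↦ ?_
  exact surjective_of_trace_two_det_three (rhoMat W (frame4 W h2))
    (exists_par_rhoMat_eq_of_two W (frame4 W h2) h2s) (exists_cm1_eq_one W h2 hK)
    (exists_cm1_add_sg_eq_one W h2 hΔ) h₃ g (mul_self_of_mul_eq_one hd)

end LevelFour

/-- `-1` is not a square in `ℚ`. [folklore] -/
private theorem not_isSquare_neg_one_rat : ¬ IsSquare (-1 : ℚ) := by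
  rintro ⟨r, hr⟩
  have := mul_self_nonneg r
  linarith

/-- **Over `ℚ`**: `ρ̄_{E,2}` onto and `-Δ ∉ ℚ^{×2}` ⟹ `ρ̄_{E,4}` onto, or a conjugate of `Im ρ̄_{E,4}`
(in the frame `LevelFour.frame4`) lies in Dokchitser–Dokchitser's `ℍ`.
[cite: DokchitserDokchitserMathZ2012, proof of Theorem (2)] -/
theorem hasSurjectiveModNGaloisRep_four_or_conj_subset_HH (W : WeierstrassCurve ℚ) [W.IsElliptic]
    (h2s : W.HasSurjectiveModNGaloisRep 2) (hΔ : ¬ IsSquare (-W.Δ)) :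
    W.HasSurjectiveModNGaloisRep 4 ∨
      ∃ k : GaloisRepresentations.GL2Mod4.M4, k.det * k.det = 1 ∧
        ∀ σ : Field.absoluteGaloisGroup ℚ, GaloisRepresentations.GL2Mod4.tup
          (k * LevelFour.M W two_ne_zero σ * GaloisRepresentations.GL2Mod4.inv' k) ∈
            GaloisRepresentations.GL2Mod4.HH :=
  LevelFour.hasSurjectiveModNGaloisRep_four_or_conj_subset_HH W two_ne_zero h2s
    not_isSquare_neg_one_rat hΔ

end Literature.NumberTheory.EllipticCurves.DokchitserDokchitser2012

end
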